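import Summits.ResolutionOfSingularities.ResolutionOfSingularities.Theorems.FrobeniusLadderFInjectiveMacaulayficationS2ModificationAffine
import Mathlib.RingTheory.IntegralClosure.IsIntegralClosure.Basic
import HarnessLib

/-!
# The affine S₂-modification algebra is the integral closure of `A` in the ring of sections off `V(𝔟)` — bridge to Mathlib's
# relative normalisation (file L4a of the `S2Modification` discharge)
# (crux `FInjectiveMacaulayfication` stmt-ResolutionOfSingularities-15315, chain w45a, hole #3γ/FC″, rung r2 input S-S2
# `FCForallExistsDimLe2.S2Modification`; sequel to `…S2ModificationAffine` p548522; res-L1-w45a-plan-1 R13.46; seat res-L1-w45a-stub-2)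

[OURS · L1 W4.5a] Support file (`--supports stmt-ResolutionOfSingularities-15315 --as helper`); NOT a statement of any manuscript; no named
fact; no definitions; AI-written (AI review is weaker than expert review).

DESIGN NOTE FOR L4 (the gluing). Mathlib HAS the relative normalisation of a qcqs morphism (`AlgebraicGeometry/Normalization.lean`:
`Scheme.Hom.normalization`, `fromNormalization`, `normalizationObjIso`, `fromNormalization_app`, `normalizationPullback` — an isomorphism
after SMOOTH base change, in particular after restriction to an open —, `IsIntegral f.normalization`, `IsIntegralHom f.fromNormalization`).
The S₂-modification of memo `D/res-D-pv-019/S2MOD-MEMO.md` §1, `X₃ = Spec_{X₂}(ν_*𝒪_{X̄} ∩ j_*𝒪_U)`, IS the relative normalisation of `X₂`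
in the OPEN SUBSCHEME `U = X₂ ∖ F`: `X₃ := (j : U ⟶ X₂).normalization`, `g := j.fromNormalization` — because over an affine open
`Spec A ⊆ X₂` with `U ∩ Spec A = ⋃_{f ∈ s} D(f)` the sections `Γ(U ∩ Spec A, 𝒪)` are `⋂_{f ∈ s} A[1/f] ⊆ K` and the integral closure of
`A` in that ring is `Ā ∩ ⋂ A[1/f] = A′ = s2Mod A K s hs`. So NO `Scheme.GlueData` is needed for L4; what is needed is this file's
ring-level bridge plus the sections computation `Γ(⋃ D(f), 𝒪_{Spec A}) = ⋂ A[1/f]` inside the function field.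

THIS FILE (ring level, any `A`-algebra `B₀` standing for `Γ(U ∩ Spec A, 𝒪)`): given an INJECTIVE `A`-algebra map `ι : B₀ → K` whose
range is `⋂_{f ∈ s} A[1/f]`,
* `isIntegral_iff_mem_s2Mod` — `b ∈ B₀` is integral over `A` iff `ι b ∈ A′`;
* `exists_algEquiv_integralClosure_s2Mod` — **`integralClosure A B₀ ≃ₐ[A] A′` compatibly with `ι`** (what identifies Mathlib's
  `normalizationObjIso` chart ring `integralClosure Γ(X₂, Spec A) Γ(U, U ∩ Spec A)` with `s2Mod`).

[folklore] [cite: EGAIV2, 5.10.16–17]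
-/

-- single-problem summit: the doubled namespace component is forced
set_option linter.dupNamespace false

noncomputable section

namespace Summit.ResolutionOfSingularities.ResolutionOfSingularities.Theorems.FInjectiveMacaulayfication.S2ModificationAffineSections

open Summit.ResolutionOfSingularities.ResolutionOfSingularities.Theorems.FInjectiveMacaulayfication
open S2ModificationAffine

variable (A : Type) [CommRing A] [IsDomain A] (K : Type) [Field K] [Algebra A K] [IsFractionRing A K]
variable (s : Finset A) (hs : ∀ f ∈ s, f ≠ 0)
variable (B₀ : Type) [CommRing B₀] [Algebra A B₀] (ι : B₀ →ₐ[A] K) (hinj : Function.Injective ι)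
  (hrange : ∀ x : K, x ∈ Set.range ι ↔ ∀ (f : A) (hf : f ∈ s), x ∈ awaySub A K f (hs f hf))

include hinj hrange in
/-- **`b ∈ Γ(U ∩ Spec A, 𝒪)` is integral over `A` iff its value in `K` lies in `A′`** (`ι` injective with range `⋂ A[1/f]`).
[folklore] -/
theorem isIntegral_iff_mem_s2Mod (b : B₀) : IsIntegral A b ↔ ι b ∈ s2Mod A K s hs := by
  rw [mem_s2Mod_iff]
  constructor
  · intro hb
    refine ⟨(isIntegral_algHom_iff ι hinj).mpr hb, fun f hf => ?_⟩
    exact (mem_awaySub_iff A K f (hs f hf) _).mp (((hrange (ι b)).mp ⟨b, rfl⟩) f hf)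
  · rintro ⟨hint, -⟩
    exact (isIntegral_algHom_iff ι hinj).mp hint

include hinj hrange in
/-- **`integralClosure A Γ(U ∩ Spec A, 𝒪) ≅ A′` over `A`, compatibly with the embeddings into `K`**: the chart ring of Mathlib's
relative normalisation of `Spec A` in `U ∩ Spec A = ⋃_{f ∈ s} D(f)` is the affine S₂-modification algebra `s2Mod A K s hs`. [folklore] -/
theorem exists_algEquiv_integralClosure_s2Mod :
    ∃ e : integralClosure A B₀ ≃ₐ[A] s2Mod A K s hs, ∀ y : integralClosure A B₀, (e y : K) = ι y := by
  have hmem : ∀ y : integralClosure A B₀, ι y ∈ s2Mod A K s hs := fun y =>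
    (isIntegral_iff_mem_s2Mod A K s hs B₀ ι hinj hrange (y : B₀)).mp y.2
  let φ : integralClosure A B₀ →ₐ[A] s2Mod A K s hs :=
    (ι.comp (integralClosure A B₀).val).codRestrict (s2Mod A K s hs) fun y => hmem y
  have hφ : ∀ y, (φ y : K) = ι y := fun _ => rfl
  refine ⟨AlgEquiv.ofBijective φ ⟨fun y z h => ?_, fun z => ?_⟩, fun y => ?_⟩
  · have h' : ι y = ι z := by rw [← hφ, ← hφ, h]
    exact Subtype.ext (hinj h')
  · -- `z ∈ A′ ⊆ ⋂ A[1/f] = range ι`, and the preimage is integral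
    obtain ⟨b, hb⟩ := (hrange (z : K)).mpr fun f hf => s2Mod_le_awaySub A K s hs f hf z.2
    have hbint : IsIntegral A b :=
      (isIntegral_iff_mem_s2Mod A K s hs B₀ ι hinj hrange b).mpr (by rw [hb]; exact z.2)
    exact ⟨⟨b, hbint⟩, Subtype.ext (by rw [hφ]; exact hb)⟩
  · exact hφ y

end Summit.ResolutionOfSingularities.ResolutionOfSingularities.Theorems.FInjectiveMacaulayfication.S2ModificationAffineSections

end
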